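import Literature.Geometry.Riemannian.DistanceSmoothOffCutLocus
import Literature.Geometry.Riemannian.NormalJacobiTensorExplicit
import Literature.Geometry.Riemannian.BonnetMyers
import Literature.Geometry.Riemannian.CutLocusConjugate
import Literature.Geometry.Riemannian.ExpMapInjectivity
import Literature.Geometry.Riemannian.SegmentInequality
import Literature.Geometry.Lorentzian.PPCurvatureSingularity
import Literature.Geometry.Riemannian.QuotientMetric
import HarnessLib

/-!
# Calabi's lemma: the far endpoint of a minimal geodesic is not a cut point of its interior
# points; smooth upper barriers for the distance function

E. Calabi (Duke Math. J. 25 (1958), 45–56) introduced the device by which the Laplacian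
comparison for `r = d(p, ·)` is used at cut points of `p`: if `γ` is a unit speed minimal
geodesic from `p` to `x = γ(T)` and `0 < ε < T`, then **`x` is not a cut point of `γ(ε)`**, so
`r_ε = ε + d(γ(ε), ·)` is SMOOTH near `x`, `r_ε ≥ r` (triangle inequality), `r_ε(x) = r(x)`, and
`Δ r_ε(x) ≤ (m-1) coth(T - ε)` (Petersen 2016, proof of Lemma 7.1.9; Cheeger–Colding 1996, §1;
Eschenburg–Heintze). We PROVE the lemma and the barrier statement:

* `Matrix.det_eq_zero_of_reversed_jacobi` — the linear-algebra heart of the symmetry of conjugate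
  points: for the matrix Jacobi systems `A'' = -R A` (`A(0) = 0`, `A'(0) = 1`) and
  `Ā'' = -R̄ Ā` (`Ā(0) = 0`) with `R̄(s) = R(t₁ - s)` symmetric, `det A(t₁) = 0` forces
  `det Ā(t₁) = 0` (the row vector `Ȳ'ᵀĀ - ȲᵀĀ'` of a reversed solution `Ȳ` is constant);
* `det_jacobi_eq_zero_of_mfderiv_expMap_eq_zero`, `injective_mfderiv_expMap_far_end` — a kernel
  vector of `d(exp_q)` at `t₁ u_q` makes the normal Jacobi tensor from `q` singular at `t₁`; hence
  **no conjugacy from an interior point `q = γ(ε)` to the far end `x = γ(T)` of a minimal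
  segment** (the normal Jacobi tensor from `x` along the reversed geodesic, in the reversed
  parallel frame, solves the reversed system, and `d(exp_x)` is injective at `(T-ε)ū ∈ ID(x)` by
  Lee's Thm. 10.26, `mfderiv_riemannianExpMap_injective_of_mem_injectivityDomain`);
* `smul_velocity_mem_injectivityDomain` — **Calabi's lemma**: for `γ(t) = exp_p(tu)`, `|u| = 1`,
  minimizing on `[0, T]`, and `0 < ε < T`, the vector `(T - ε) γ̇(ε)` lies in the injectivity
  domain `ID(γ(ε))` (Klingenberg's dichotomy `isConjugateVector_or_exists_ne_of_mem_tangentCutLocus`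
  at `γ(ε)`; a second minimizer is excluded by corner cutting at `x` (`false_of_two_minimizers`,
  the reversed segment from `x` extends minimally to `p`), and a conjugate vector by the matrix
  symmetry above together with Lee's Thm. 10.26 at `x`
  (`mfderiv_riemannianExpMap_injective_of_mem_injectivityDomain`) — the normal Jacobi tensors of
  `NormalJacobiTensorExplicit.lean` from `γ(ε)` forwards and from `x` backwards in a parallel
  frame and its reversal);
* `exists_smooth_upper_barrier_edist` — **Calabi's smooth upper barriers**: under
  `Ric ≥ -(m-1) g`, for `x ≠ p` and `0 < ε < d(p, x)` there is a function `b`, `C^∞` near `x`,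
  with `b ≥ d(p, ·)` near `x`, `b(x) = d(p, x)` and `Δ_g b(x) ≤ (m-1) coth(d(p,x) - ε)`
  (`DistanceSmoothOffCutLocus.lean`).

No definitions, no named facts (D-0026). Groundwork for `CheegerColding1997_sphereStability`.

## References

* E. Calabi, *An extension of E. Hopf's maximum principle with an application to Riemannian
  geometry*, Duke Math. J. 25 (1958) 45–56. [Calabi1958]
* P. Petersen, *Riemannian Geometry*, 3rd ed. (2016), Lemma 7.1.9 (proof). [Petersen2016]
* J. M. Lee, *Introduction to Riemannian Manifolds*, 2nd ed. (2018), Thm. 10.26, Prop. 10.32,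
  Thm. 10.34. [LeeRiemannianManifolds2018]
-/

noncomputable section

open Bundle Set Function Filter
open scoped Manifold ContDiff Topology ENNReal NNReal Real Matrix

namespace Literature.Geometry.Riemannian

open Lorentzian Lorentzian.PseudoRiemannianMetric

/-! ### §1 The matrix heart: reversed solutions of the Jacobi system -/

section MatrixODE

variable {ι : Type*} [Fintype ι] [DecidableEq ι]

omit [DecidableEq ι] in
/-- Derivative of `t ↦ A t *ᵥ c`. [folklore] -/
theorem hasDerivAt_mulVec_const {A : ℝ → Matrix ι ι ℝ} {A' : Matrix ι ι ℝ} {t : ℝ}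
    (hA : HasDerivAt A A' t) (c : ι → ℝ) : HasDerivAt (fun t ↦ A t *ᵥ c) (A' *ᵥ c) t := by
  rw [hasDerivAt_pi]
  intro i
  have hAij : ∀ j, HasDerivAt (fun t ↦ A t i j) (A' i j) t := fun j ↦
    hasDerivAt_pi.1 (hasDerivAt_pi.1 hA i) j
  simp only [Matrix.mulVec, dotProduct]
  exact HasDerivAt.fun_sum (u := Finset.univ) fun j _ ↦ (hAij j).mul_const (c j)

omit [DecidableEq ι] in
/-- Derivative of `t ↦ y t ᵥ* A t`. [folklore] -/
theorem hasDerivAt_vecMul {A : ℝ → Matrix ι ι ℝ} {A' : Matrix ι ι ℝ} {y : ℝ → ι → ℝ}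
    {y' : ι → ℝ} {t : ℝ} (hy : HasDerivAt y y' t) (hA : HasDerivAt A A' t) :
    HasDerivAt (fun t ↦ y t ᵥ* A t) (y' ᵥ* A t + y t ᵥ* A') t := by
  rw [hasDerivAt_pi]
  intro j
  have hAij : ∀ i, HasDerivAt (fun t ↦ A t i j) (A' i j) t := fun i ↦
    hasDerivAt_pi.1 (hasDerivAt_pi.1 hA i) j
  have hyi : ∀ i, HasDerivAt (fun t ↦ y t i) (y' i) t := fun i ↦ hasDerivAt_pi.1 hy i
  simp only [Matrix.vecMul, dotProduct, Pi.add_apply]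
  have h := HasDerivAt.fun_sum (u := Finset.univ) fun i _ ↦ (hyi i).fun_mul (hAij i)
  rw [← Finset.sum_add_distrib]
  exact h

/-- **Symmetry of conjugate points, matrix form.** Let `A, A₁, R` and `B, B₁, S` be matrix
curves with `A' = A₁`, `A₁' = -R A` on an open interval containing `[0, t₁]` and likewise for
the barred system, `A(0) = 0`, `A₁(0) = 1`, `B(0) = 0`, `S(s)` symmetric and `S(s) = R(t₁ - s)`
for `s ∈ [0, t₁]`. If `det A(t₁) = 0` then `det B(t₁) = 0`. Proof: pick `c ≠ 0` with
`A(t₁) c = 0` and put `Y = A c`, `Z(s) = Y(t₁ - s)`; then `Z'' = -S Z`, and the row vector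
`P = Z'ᵀ B - Zᵀ B₁` has `P' = -(SZ)ᵀB + ZᵀSB = 0`, `P(0) = 0` (`B(0) = 0`, `Z(0) = Y(t₁) = 0`),
so `0 = P(t₁) = Z'(t₁)ᵀ B(t₁)` with `Z'(t₁) = -Y'(0) = -c ≠ 0`. [folklore] -/
theorem Matrix.det_eq_zero_of_reversed_jacobi {A A₁ R B B₁ S : ℝ → Matrix ι ι ℝ} {a b t₁ : ℝ}
    (ha : a < 0) (hb : t₁ < b) (ht₁ : 0 ≤ t₁)
    (hA : ∀ t ∈ Ioo a b, HasDerivAt A (A₁ t) t) (hA₁ : ∀ t ∈ Ioo a b, HasDerivAt A₁ (-(R t * A t)) t)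
    (hA0 : A 0 = 0) (hA₁0 : A₁ 0 = 1)
    (hB : ∀ s ∈ Ioo a b, HasDerivAt B (B₁ s) s) (hB₁ : ∀ s ∈ Ioo a b, HasDerivAt B₁ (-(S s * B s)) s)
    (hB0 : B 0 = 0) (hsymm : ∀ s ∈ Ioo a b, (S s).IsSymm)
    (hrev : ∀ s ∈ Ioo a b, t₁ - s ∈ Ioo a b → S s = R (t₁ - s))
    (hdet : (A t₁).det = 0) : (B t₁).det = 0 := by
  obtain ⟨c, hc0, hc⟩ := Matrix.exists_mulVec_eq_zero_iff.2 hdet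
  -- the solution `Y = A c` and its reversal
  set Y : ℝ → ι → ℝ := fun t ↦ A t *ᵥ c with hY
  set Y₁ : ℝ → ι → ℝ := fun t ↦ A₁ t *ᵥ c with hY₁
  have hYd : ∀ t ∈ Ioo a b, HasDerivAt Y (Y₁ t) t := fun t ht ↦ hasDerivAt_mulVec_const (hA t ht) c
  have hY₁d : ∀ t ∈ Ioo a b, HasDerivAt Y₁ (-(R t *ᵥ Y t)) t := by
    intro t ht
    have h := hasDerivAt_mulVec_const (hA₁ t ht) c
    simp only [Matrix.neg_mulVec, ← Matrix.mulVec_mulVec] at h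
    exact h
  set Z : ℝ → ι → ℝ := fun s ↦ Y (t₁ - s) with hZ
  set Z₁ : ℝ → ι → ℝ := fun s ↦ -Y₁ (t₁ - s) with hZ₁
  have hrefl : ∀ s, HasDerivAt (fun s : ℝ ↦ t₁ - s) (-1) s := fun s ↦
    (hasDerivAt_id s).const_sub t₁
  have hZd : ∀ s ∈ Ioo a b, t₁ - s ∈ Ioo a b → HasDerivAt Z (Z₁ s) s := by
    intro s hs hs'
    have h := (hYd _ hs').scomp s (hrefl s)
    refine h.congr_deriv ?_
    simp [hZ₁]
  have hZ₁d : ∀ s ∈ Ioo a b, t₁ - s ∈ Ioo a b → HasDerivAt Z₁ (-(S s *ᵥ Z s)) s := by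
    intro s hs hs'
    have h := ((hY₁d _ hs').scomp s (hrefl s)).neg
    refine h.congr_deriv ?_
    rw [hrev s hs hs']
    simp [hZ]
  -- the conserved row vector
  set P : ℝ → ι → ℝ := fun s ↦ Z₁ s ᵥ* B s - Z s ᵥ* B₁ s with hP
  have hPd : ∀ s ∈ Ioo a b, t₁ - s ∈ Ioo a b → HasDerivAt P 0 s := by
    intro s hs hs'
    have h1 := hasDerivAt_vecMul (hZ₁d s hs hs') (hB s hs)
    have h2 := hasDerivAt_vecMul (hZd s hs hs') (hB₁ s hs)
    have h := h1.sub h2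
    refine h.congr_deriv ?_
    have hRt : (S s)ᵀ = S s := hsymm s hs
    rw [Matrix.neg_vecMul, Matrix.vecMul_neg, ← Matrix.vecMul_transpose, hRt, Matrix.vecMul_vecMul]
    -- `-(Z ᵥ* S ᵥ* B) + Z₁ ᵥ* B₁ - (Z₁ ᵥ* B₁ + -(Z ᵥ* (S * B))) = 0`
    abel
  -- `P` is constant on `[0, t₁]`
  have hPconst : P t₁ = P 0 := by
    have hmem : ∀ s ∈ Icc (0 : ℝ) t₁, s ∈ Ioo a b ∧ t₁ - s ∈ Ioo a b := fun s hs ↦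
      ⟨⟨by linarith [hs.1], by linarith [hs.2]⟩, ⟨by linarith [hs.2], by linarith [hs.1]⟩⟩
    have h := Convex.norm_image_sub_le_of_norm_hasDerivWithin_le (f := P) (f' := fun _ ↦ 0)
      (s := Icc (0 : ℝ) t₁) (C := 0)
      (fun s hs ↦ ((hPd s (hmem s hs).1 (hmem s hs).2).hasDerivWithinAt))
      (fun _ _ ↦ by simp) (convex_Icc 0 t₁) (left_mem_Icc.2 ht₁) (right_mem_Icc.2 ht₁)
    rw [zero_mul, norm_le_zero_iff, sub_eq_zero] at h
    exact h
  -- evaluate at `0` and at `t₁`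
  have hP0 : P 0 = 0 := by
    simp only [hP, hZ, hY, sub_zero, hB0, Matrix.vecMul_zero, hc, Matrix.zero_vecMul]
  have hPt : P t₁ = (-c) ᵥ* B t₁ := by
    simp only [hP, hZ, hZ₁, hY, hY₁, sub_self, hA0, hA₁0, Matrix.zero_mulVec, Matrix.one_mulVec,
      Matrix.zero_vecMul, sub_zero]
  rw [hP0, hPt] at hPconst
  exact Matrix.exists_vecMul_eq_zero_iff.1 ⟨-c, neg_ne_zero.2 hc0, hPconst⟩

end MatrixODE
/-! ### §2 Minimal geodesics: sub-segments, shifted and reversed parametrisations -/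

section Geodesics

variable {E : Type*} [NormedAddCommGroup E] [NormedSpace ℝ E] [FiniteDimensional ℝ E]
  [CompleteSpace E] {M : Type*} [TopologicalSpace M] [ChartedSpace E M] [IsManifold 𝓘(ℝ, E) ∞ M]
  [T2Space M]
  (g : PseudoRiemannianMetric 𝓘(ℝ, E) ∞ E (TangentSpace 𝓘(ℝ, E) : M → Type _)) [g.HasLeviCivita]
  [CovariantDerivative.ContMDiffCovariantDerivative g.leviCivita 1]

/-- **Sub-segments of a minimal segment realise the distance**: if `γ_u|[0, T]` is minimizing
(`|u| = 1`) then `d(γ_u(s), γ_u(t)) = t - s` for `0 ≤ s ≤ t ≤ T`. [folklore] -/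
theorem edist_expMap_smul_expMap_smul (hg : g.IsRiemannian) (hc : IsGeodesicallyComplete g.leviCivita)
    (p : M) (u : TangentSpace 𝓘(ℝ, E) p) (hu : g.val p u u = 1) {T : ℝ}
    (hmin : IsMinimizingUpTo g hg p u T) {s t : ℝ} (hs : 0 ≤ s) (hst : s ≤ t) (ht : t ≤ T) :
    g.edist hg (expMap g.leviCivita p (s • u)) (expMap g.leviCivita p (t • u)) =
      ENNReal.ofReal (t - s) := by
  haveI : Fact ((1 : ℕ∞ω) ≤ (∞ : ℕ∞ω)) := ⟨by exact_mod_cast le_top⟩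
  obtain ⟨-, -, hγ0, -⟩ := maximalGeodesic_of_isGeodesicallyComplete hc p u
  have hlen : ∀ a b : ℝ, g.length hg (maximalGeodesic g.leviCivita p u) a b =
      ENNReal.ofReal (b - a) := fun a b ↦ by
    rw [length_maximalGeodesic hg hc p u a b, hu, Real.sqrt_one, mul_one]
  have hle : ∀ {a b : ℝ}, a ≤ b → g.edist hg (expMap g.leviCivita p (a • u))
      (expMap g.leviCivita p (b • u)) ≤ ENNReal.ofReal (b - a) := fun {a b} hab ↦ by
    rw [expMap_smul hc p u a, expMap_smul hc p u b, ← hlen a b]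
    exact edist_maximalGeodesic_le_length hg hc p u hab
  refine le_antisymm (hle hst) ?_
  -- the triangle inequality through `γ s` and `γ t`
  have hT : g.edist hg p (expMap g.leviCivita p (T • u)) = ENNReal.ofReal T := by
    rw [expMap_smul hc p u T, ← hmin.2, hlen, sub_zero]
  have h0 : expMap g.leviCivita p ((0 : ℝ) • u) = p := by
    rw [zero_smul]; exact expMap_zero (cov := g.leviCivita) p
  have h1 : g.edist hg p (expMap g.leviCivita p (s • u)) ≤ ENNReal.ofReal s := by
    have h := hle hs
    rwa [h0, sub_zero] at h
  have h2 : g.edist hg (expMap g.leviCivita p (t • u)) (expMap g.leviCivita p (T • u)) ≤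
      ENNReal.ofReal (T - t) := hle ht
  set d := g.edist hg (expMap g.leviCivita p (s • u)) (expMap g.leviCivita p (t • u)) with hd
  have hdfin : d ≠ ⊤ := ne_top_of_le_ne_top ENNReal.ofReal_ne_top (hle hst)
  have htri : ENNReal.ofReal T ≤ ENNReal.ofReal s + d + ENNReal.ofReal (T - t) := by
    rw [← hT]
    have tri1 : g.edist hg p (expMap g.leviCivita p (T • u)) ≤
        g.edist hg p (expMap g.leviCivita p (s • u)) +
          g.edist hg (expMap g.leviCivita p (s • u)) (expMap g.leviCivita p (T • u)) :=
      g.edist_triangle hg _ _ _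
    have tri2 : g.edist hg (expMap g.leviCivita p (s • u)) (expMap g.leviCivita p (T • u)) ≤
        d + g.edist hg (expMap g.leviCivita p (t • u)) (expMap g.leviCivita p (T • u)) :=
      g.edist_triangle hg _ _ _
    calc g.edist hg p (expMap g.leviCivita p (T • u))
        ≤ g.edist hg p (expMap g.leviCivita p (s • u)) +
          (d + g.edist hg (expMap g.leviCivita p (t • u)) (expMap g.leviCivita p (T • u))) :=
          tri1.trans (add_le_add le_rfl tri2)
      _ ≤ ENNReal.ofReal s + (d + ENNReal.ofReal (T - t)) :=
          add_le_add h1 (add_le_add le_rfl h2)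
      _ = ENNReal.ofReal s + d + ENNReal.ofReal (T - t) := (add_assoc _ _ _).symm
  rw [← ENNReal.ofReal_toReal hdfin] at htri ⊢
  rw [← ENNReal.ofReal_add hs ENNReal.toReal_nonneg,
    ← ENNReal.ofReal_add (add_nonneg hs ENNReal.toReal_nonneg) (by linarith)] at htri
  have h := (ENNReal.ofReal_le_ofReal_iff (by positivity)).1 htri
  exact ENNReal.ofReal_le_ofReal (by linarith)

/-- **The shifted parametrisation**: for `γ(t) = exp_p(tu)` and `γ_q = γ_{γ̇(ε)}` the geodesic from
`q = γ(ε)`, `γ_q(σ) = γ(ε + σ)` (`expMap_smul_velocity_eq`). [folklore] -/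
theorem maximalGeodesic_velocity_eq [CovariantDerivative.ContMDiffCovariantDerivative g.leviCivita ∞]
    (hc : IsGeodesicallyComplete g.leviCivita) (p : M) (u : TangentSpace 𝓘(ℝ, E) p) (ε σ : ℝ) :
    maximalGeodesic g.leviCivita (expMap g.leviCivita p (ε • u))
        (velocity 𝓘(ℝ, E) (fun t ↦ expMap g.leviCivita p (t • u)) ε) σ =
      expMap g.leviCivita p ((ε + σ) • u) := by
  rw [← expMap_smul hc, expMap_smul_velocity_eq g hc p u ε σ]

/-- The speed of `γ(t) = exp_p(tu)` is `|u|`: `g(γ̇(t), γ̇(t)) = g(u, u)`. [folklore] -/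
theorem val_velocity_expMap_smul [CovariantDerivative.ContMDiffCovariantDerivative g.leviCivita ∞]
    (hc : IsGeodesicallyComplete g.leviCivita) (p : M) (u : TangentSpace 𝓘(ℝ, E) p) (t : ℝ) :
    g.val (expMap g.leviCivita p (t • u)) (velocity 𝓘(ℝ, E) (fun t ↦ expMap g.leviCivita p (t • u)) t)
      (velocity 𝓘(ℝ, E) (fun t ↦ expMap g.leviCivita p (t • u)) t) = g.val p u u := by
  haveI : Fact ((1 : ℕ∞ω) ≤ (∞ : ℕ∞ω)) := ⟨by exact_mod_cast le_top⟩
  have hgeo : IsGeodesic g.leviCivita (fun t : ℝ ↦ expMap g.leviCivita p (t • u)) :=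
    isGeodesic_expMap_smul_of_isGeodesicallyComplete hc p u
  have h := g.val_velocity_eq_of_isGeodesicOn_holds isOpen_univ ordConnected_univ hgeo
    (mem_univ t) (mem_univ 0)
  have hv0 : (velocity 𝓘(ℝ, E) (fun t : ℝ ↦ expMap g.leviCivita p (t • u)) 0 : E) = (u : E) :=
    velocity_expMap_smul_zero p u
  have h0 : expMap g.leviCivita p ((0 : ℝ) • u) = p := by
    rw [zero_smul]; exact expMap_zero (cov := g.leviCivita) p
  rw [h, hv0, h0]

/-- **The reversed segment from the far end extends minimally**: for `γ(t) = exp_p(tu)`,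
`|u| = 1`, minimizing on `[0, T]`, the reversed curve `σ(s) = γ(T - s)` is the geodesic
`γ_{ū}` from `x = γ(T)` with `ū = -γ̇(T)`, `|ū| = 1`, minimizing on `[0, T]`; in particular
`t₁ ū ∈ ID(x)` for `0 < t₁ < T`, and `exp_x(s ū) = γ(T - s)`. [folklore] -/
theorem exists_reversed_unit [CovariantDerivative.ContMDiffCovariantDerivative g.leviCivita ∞]
    (hg : g.IsRiemannian) (hc : IsGeodesicallyComplete g.leviCivita)
    (p : M) (u : TangentSpace 𝓘(ℝ, E) p) (hu : g.val p u u = 1) {T : ℝ} (hT : 0 < T)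
    (hmin : IsMinimizingUpTo g hg p u T) :
    ∃ ū : TangentSpace 𝓘(ℝ, E) (expMap g.leviCivita p (T • u)),
      g.val (expMap g.leviCivita p (T • u)) ū ū = 1 ∧
      (∀ s : ℝ, maximalGeodesic g.leviCivita (expMap g.leviCivita p (T • u)) ū s =
        expMap g.leviCivita p ((T - s) • u)) ∧
      (∀ s : ℝ, velocity 𝓘(ℝ, E) (maximalGeodesic g.leviCivita (expMap g.leviCivita p (T • u)) ū) s =
        (-1 : ℝ) • velocity 𝓘(ℝ, E) (fun t ↦ expMap g.leviCivita p (t • u)) (T - s)) ∧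
      IsMinimizingUpTo g hg (expMap g.leviCivita p (T • u)) ū T := by
  haveI : Fact ((1 : ℕ∞ω) ≤ (∞ : ℕ∞ω)) := ⟨by exact_mod_cast le_top⟩
  set γ : ℝ → M := fun t ↦ expMap g.leviCivita p (t • u) with hγ_def
  have hgeo : IsGeodesic g.leviCivita γ := isGeodesic_expMap_smul_of_isGeodesicallyComplete hc p u
  set ρ : ℝ → M := fun s ↦ γ (-1 * s + T) with hρ_def
  have hρgeo : IsGeodesic g.leviCivita ρ := hgeo.comp_affine (-1) T
  have hρ0 : ρ 0 = expMap g.leviCivita p (T • u) := by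
    show γ (-1 * 0 + T) = _
    rw [mul_zero, zero_add]
  set ū : TangentSpace 𝓘(ℝ, E) (expMap g.leviCivita p (T • u)) :=
    (show TangentSpace 𝓘(ℝ, E) (expMap g.leviCivita p (T • u)) from
      ((velocity 𝓘(ℝ, E) ρ 0 : TangentSpace 𝓘(ℝ, E) (ρ 0)) : E)) with hū_def
  have hlift : tangentLift 𝓘(ℝ, E) ρ 0 =
      (⟨expMap g.leviCivita p (T • u), ū⟩ : TangentBundle 𝓘(ℝ, E) M) :=
    TotalSpace.ext hρ0 HEq.rfl
  have hρeq : ρ = maximalGeodesic g.leviCivita (expMap g.leviCivita p (T • u)) ū :=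
    hρgeo.eq_maximalGeodesic hlift
  have hpath : ∀ s : ℝ, maximalGeodesic g.leviCivita (expMap g.leviCivita p (T • u)) ū s =
      expMap g.leviCivita p ((T - s) • u) := fun s ↦ by
    rw [← congrFun hρeq s]
    show γ (-1 * s + T) = γ (T - s)
    ring_nf
  have hvel : ∀ s : ℝ, velocity 𝓘(ℝ, E) ρ s = (-1 : ℝ) • velocity 𝓘(ℝ, E) γ (-1 * s + T) :=
    fun s ↦ velocity_comp_affine γ (-1) T s
  have hvel' : ∀ s : ℝ, velocity 𝓘(ℝ, E)
      (maximalGeodesic g.leviCivita (expMap g.leviCivita p (T • u)) ū) s =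
      (-1 : ℝ) • velocity 𝓘(ℝ, E) γ (T - s) := fun s ↦ by
    rw [← hρeq, hvel s]
    congr 2
    ring
  have hnorm : g.val (expMap g.leviCivita p (T • u)) ū ū = 1 := by
    have h1 : g.val (ρ 0) (velocity 𝓘(ℝ, E) ρ 0) (velocity 𝓘(ℝ, E) ρ 0) = 1 := by
      rw [hvel 0]
      simp only [map_smul, FunLike.coe_smul, Pi.smul_apply, smul_eq_mul]
      have h3 := val_velocity_expMap_smul g hc p u (-1 * 0 + T)
      rw [hu] at h3
      have h4 : ρ 0 = γ (-1 * 0 + T) := rfl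
      rw [h4, h3]
      ring
    rwa [hρ0] at h1
  refine ⟨ū, hnorm, hpath, hvel', ?_⟩
  -- minimality on `[0, T]`: length `T`, `d(x, p) = T`
  obtain ⟨hdom, -, -, -⟩ := maximalGeodesic_of_isGeodesicallyComplete hc (expMap g.leviCivita p (T • u)) ū
  refine ⟨by rw [hdom]; exact subset_univ _, ?_⟩
  rw [length_maximalGeodesic hg hc _ ū 0 T, hnorm, Real.sqrt_one, mul_one, sub_zero, hpath T,
    sub_self, zero_smul, expMap_zero (cov := g.leviCivita), g.edist_comm hg]
  have h := edist_expMap_smul_expMap_smul g hg hc p u hu hmin (s := 0) (t := T) le_rfl hT.le le_rfl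
  rw [zero_smul, expMap_zero (cov := g.leviCivita), sub_zero] at h
  exact h.symm

end Geodesics
/-! ### §3 The conjugate case: symmetry of conjugacy along a minimal segment -/

section Conjugate

variable {E : Type*} [NormedAddCommGroup E] [NormedSpace ℝ E] [FiniteDimensional ℝ E]
  [CompleteSpace E] {M : Type*} [TopologicalSpace M] [ChartedSpace E M] [IsManifold 𝓘(ℝ, E) ∞ M]
  [T2Space M]
  (g : PseudoRiemannianMetric 𝓘(ℝ, E) ∞ E (TangentSpace 𝓘(ℝ, E) : M → Type _)) [g.HasLeviCivita]
  [CovariantDerivative.ContMDiffCovariantDerivative g.leviCivita 1]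
  [CovariantDerivative.ContMDiffCovariantDerivative g.leviCivita ∞]

omit [CompleteSpace E] [T2Space M] [CovariantDerivative.ContMDiffCovariantDerivative g.leviCivita 1]
  [CovariantDerivative.ContMDiffCovariantDerivative g.leviCivita ∞] in
/-- Transport of parallelism along an equality of curves (all tangent spaces are `E`).
[folklore] -/
theorem isParallelAlongOn_congr_curve {γ₁ γ₂ : ℝ → M} (h : γ₁ = γ₂)
    {W : Π t : ℝ, TangentSpace 𝓘(ℝ, E) (γ₁ t)} {s : Set ℝ}
    (hW : IsParallelAlongOn g.leviCivita γ₁ W s) :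
    IsParallelAlongOn g.leviCivita γ₂ (fun t ↦ (show TangentSpace 𝓘(ℝ, E) (γ₂ t) from (W t : E))) s := by
  subst h
  exact hW

set_option maxHeartbeats 800000 in
/-- **A kernel vector of `d(exp_q)` at `t₁ u_q` kills the normal Jacobi tensor**: along
`γ = γ_{u_q}` with a `g`-orthonormal frame `f(t)` headed by `γ̇(t)` (`|u_q| = 1`) and the
variation fields `J_j(t) = ∂_s|₀ γ_{u_q + s w_j}(t)`, `w_j = f(0)(some j)`, normal to `γ̇`: if
`d(exp_q)_{t₁ u_q}(k) = 0` with `k ≠ 0`, `t₁ ≠ 0`, then `det (g(J_j(t₁), f_i(t₁))) = 0` — the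
radial component of `k` vanishes (pair with `γ̇(t₁)`: `d(exp_q)_{t₁u_q}(t₁ u_q) = t₁ γ̇(t₁)` and
the `J_j` are normal) and the normal components `c ≠ 0` give `Σ c_j J_j(t₁) = 0`. [folklore] -/
theorem det_jacobi_eq_zero_of_mfderiv_expMap_eq_zero
    (hc : IsGeodesicallyComplete g.leviCivita) (q : M) (uq : TangentSpace 𝓘(ℝ, E) q)
    {k' : ℕ} {a b : ℝ} (f : Π t : ℝ, Option (Fin k') →
      TangentSpace 𝓘(ℝ, E) (maximalGeodesic g.leviCivita q uq t))
    (hfnone : ∀ t, f t none = velocity 𝓘(ℝ, E) (maximalGeodesic g.leviCivita q uq) t)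
    (hon : ∀ t ∈ Ioo a b, ∀ o o', g.val (maximalGeodesic g.leviCivita q uq t) (f t o) (f t o') =
      if o = o' then 1 else 0)
    (hcard : Fintype.card (Option (Fin k')) = Module.finrank ℝ E) (h0 : (0 : ℝ) ∈ Ioo a b)
    (w : Fin k' → TangentSpace 𝓘(ℝ, E) q) (hw : ∀ j, w j = f 0 (some j))
    {t₁ : ℝ} (ht₁ : t₁ ∈ Ioo a b) (ht₁0 : t₁ ≠ 0)
    (hnormal : ∀ j, g.val (maximalGeodesic g.leviCivita q uq t₁)
      (velocity 𝓘(ℝ, E) (fun s' : ℝ ↦ maximalGeodesic g.leviCivita q (uq + s' • w j) t₁) 0)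
      (velocity 𝓘(ℝ, E) (maximalGeodesic g.leviCivita q uq) t₁) = 0)
    {k : E} (hk0 : k ≠ 0)
    (hk : mfderiv 𝓘(ℝ, E) 𝓘(ℝ, E) (fun w : E ↦ expMap g.leviCivita q (show TangentSpace 𝓘(ℝ, E) q from w))
      (t₁ • (show E from uq)) k = 0) :
    (Matrix.of fun i j ↦ g.val (maximalGeodesic g.leviCivita q uq t₁)
      (velocity 𝓘(ℝ, E) (fun s' : ℝ ↦ maximalGeodesic g.leviCivita q (uq + s' • w j) t₁) 0)
      (f t₁ (some i))).det = 0 := by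
  classical
  haveI : Fact ((1 : ℕ∞ω) ≤ (∞ : ℕ∞ω)) := ⟨by exact_mod_cast le_top⟩
  obtain ⟨-, -, hγ0, hγv⟩ := maximalGeodesic_of_isGeodesicallyComplete hc q uq
  by_contra hdet
  -- opaque names: `J j = J_j(t₁)`, `V = γ̇(t₁)`, `L = d(exp_q)_{t₁ u_q}`
  obtain ⟨J, hJ⟩ : ∃ J : Fin k' → TangentSpace 𝓘(ℝ, E) (maximalGeodesic g.leviCivita q uq t₁),
      ∀ j, J j = velocity 𝓘(ℝ, E) (fun s' : ℝ ↦ maximalGeodesic g.leviCivita q (uq + s' • w j) t₁) 0 :=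
    ⟨_, fun j ↦ rfl⟩
  obtain ⟨V, hV⟩ : ∃ V : TangentSpace 𝓘(ℝ, E) (maximalGeodesic g.leviCivita q uq t₁),
      V = velocity 𝓘(ℝ, E) (maximalGeodesic g.leviCivita q uq) t₁ := ⟨_, rfl⟩
  set L := mfderiv 𝓘(ℝ, E) 𝓘(ℝ, E)
    (fun w : E ↦ expMap g.leviCivita q (show TangentSpace 𝓘(ℝ, E) q from w)) (t₁ • (show E from uq))
    with hL
  have hJL : ∀ j, J j = L (t₁ • (show E from w j)) := fun j ↦
    (hJ j).trans (velocity_geodesicVariation_eq_mfderiv_expMap hc q uq (w j) t₁)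
  have hnormal' : ∀ j, g.val (maximalGeodesic g.leviCivita q uq t₁) (J j) V = 0 := fun j ↦ by
    rw [hJ, hV]; exact hnormal j
  -- the radial derivative: `L(t₁ u_q) = t₁ γ̇(t₁)`
  have hrad : L (t₁ • (show E from uq)) = t₁ • (show E from V) := by
    have h := velocity_geodesicVariation_eq_mfderiv_expMap hc q uq uq t₁
    refine h.symm.trans ?_
    have hcurve : ∀ s' : ℝ, maximalGeodesic g.leviCivita q (uq + s' • uq) t₁ =
        maximalGeodesic g.leviCivita q uq (t₁ * s' + t₁) := fun s' ↦ by
      have h1 : uq + s' • uq = (1 + s') • uq := by rw [add_smul, one_smul]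
      rw [h1, maximalGeodesic_smul hc q uq (1 + s') t₁]
      exact congrArg (maximalGeodesic g.leviCivita q uq) (by ring)
    rw [velocity_congr_of_forall (γ := fun s' : ℝ ↦ maximalGeodesic g.leviCivita q uq (t₁ * s' + t₁))
      (γ' := fun s' : ℝ ↦ maximalGeodesic g.leviCivita q (uq + s' • uq) t₁) hcurve 0,
      velocity_comp_affine (maximalGeodesic g.leviCivita q uq) t₁ t₁ 0, hV]
    show t₁ • (show E from velocity 𝓘(ℝ, E) (maximalGeodesic g.leviCivita q uq) (t₁ * 0 + t₁)) = _
    rw [velocity_congr_point (I := 𝓘(ℝ, E)) (γ := maximalGeodesic g.leviCivita q uq)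
      (show t₁ * 0 + t₁ = t₁ by ring)]
  -- expansion of `k` in the orthonormal frame `f 0`: `k = c₀ u_q + Σ c_j w_j`
  have hexp := eq_sum_bilin_smul_of_orthonormal (V := E) (g.val (maximalGeodesic g.leviCivita q uq 0))
    (hon 0 h0) hcard (show TangentSpace 𝓘(ℝ, E) (maximalGeodesic g.leviCivita q uq 0) from k)
  set c : Fin k' → ℝ := fun j ↦ g.val (maximalGeodesic g.leviCivita q uq 0) k (f 0 (some j)) with hc_def
  set c₀ : ℝ := g.val (maximalGeodesic g.leviCivita q uq 0) k (f 0 none) with hc₀_def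
  have hfu : (show E from f 0 none) = (show E from uq) := by rw [hfnone 0, hγv]
  have hexp' : k = c₀ • (show E from uq) + ∑ j, c j • (show E from w j) := by
    refine hexp.trans ?_
    rw [Fintype.sum_option]
    show c₀ • (show E from f 0 none) + ∑ j, c j • (show E from f 0 (some j)) = _
    rw [hfu]
    congr 1
    exact Finset.sum_congr rfl fun j _ ↦ by rw [hw j]
  -- `u = Σ c_j J_j(t₁) = L(t₁ Σ c_j w_j)` (as in `det_frameMatrix_ne_zero_of_…_normal`)
  obtain ⟨u, hu⟩ : ∃ u : TangentSpace 𝓘(ℝ, E) (maximalGeodesic g.leviCivita q uq t₁),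
      u = ∑ j, c j • J j := ⟨_, rfl⟩
  have h1 : L (t₁ • ∑ j, c j • (show E from w j)) = ∑ j, c j • L (t₁ • (show E from w j)) := by
    calc L (t₁ • ∑ j, c j • (show E from w j)) = L (∑ j, t₁ • (c j • (show E from w j))) := by
          rw [Finset.smul_sum]; rfl
      _ = ∑ j, L (t₁ • (c j • (show E from w j))) := map_sum L _ _
      _ = ∑ j, c j • L (t₁ • (show E from w j)) := Finset.sum_congr rfl fun j _ ↦ by
          rw [smul_comm]; exact map_smul L (c j) _
  have huL : u = L (t₁ • ∑ j, c j • (show E from w j)) := by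
    rw [h1, hu]
    exact Finset.sum_congr rfl fun j _ ↦ congrArg (fun z ↦ c j • z) (hJL j)
  -- `0 = L(t₁ k) = c₀ t₁ V + u`
  have h2 : L (t₁ • k) = 0 :=
    ((map_smul L t₁ k).trans (congrArg (fun z ↦ t₁ • z) hk)).trans (smul_zero t₁)
  have h3 : L (t₁ • k) = c₀ • L (t₁ • (show E from uq)) + L (t₁ • ∑ j, c j • (show E from w j)) := by
    have h4 : t₁ • k = c₀ • (t₁ • (show E from uq)) + t₁ • ∑ j, c j • (show E from w j) := by
      rw [hexp', smul_add, smul_comm]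
    rw [h4]
    exact (map_add L _ _).trans (by congr 1; exact map_smul L c₀ _)
  have h5 : c₀ • L (t₁ • (show E from uq)) + L (t₁ • ∑ j, c j • (show E from w j)) =
      c₀ • (t₁ • (show E from V)) + (show E from u) :=
    congrArg₂ (· + ·) (congrArg (fun z ↦ c₀ • z) hrad) huL.symm
  -- read `0 = L(t₁ k) = c₀ t₁ V + u` in `T_{γ(t₁)}M`
  have hLk : c₀ • (t₁ • V) + u = 0 := ((h3.symm.trans h2).symm.trans h5).symm
  -- pair with `V`: `c₀ = 0` (`g(V, V) = 1`, `g(J_j, V) = 0`)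
  have hvv : g.val (maximalGeodesic g.leviCivita q uq t₁) V V = 1 := by
    have h := hon t₁ ht₁ none none
    rw [hfnone t₁, ← hV] at h
    simpa using h
  have huV : g.val (maximalGeodesic g.leviCivita q uq t₁) u V = 0 := by
    simp only [hu, map_sum, map_smul, FunLike.coe_sum, FunLike.coe_smul, Finset.sum_apply,
      Pi.smul_apply, smul_eq_mul]
    exact Finset.sum_eq_zero fun j _ ↦ by rw [hnormal' j, mul_zero]
  have hc₀ : c₀ = 0 := by
    have h := congrArg (fun z ↦ g.val (maximalGeodesic g.leviCivita q uq t₁) z V) hLk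
    simp only [map_add, map_smul, add_apply, FunLike.coe_smul, Pi.smul_apply, smul_eq_mul, hvv, huV,
      map_zero, zero_apply, mul_one, add_zero] at h
    rcases mul_eq_zero.1 h with h5 | h5
    · exact h5
    · exact absurd h5 ht₁0
  -- so `u = 0` with `c ≠ 0`
  have hu0 : u = 0 := by
    have h := hLk
    rw [hc₀, zero_smul, zero_add] at h
    exact h
  have hcne : c ≠ 0 := by
    intro hc0
    apply hk0
    have hcj : ∀ j, c j = 0 := fun j ↦ congrFun hc0 j
    refine hexp'.trans ?_
    rw [hc₀, zero_smul, zero_add]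
    exact Finset.sum_eq_zero fun j _ ↦ by rw [hcj j, zero_smul]
  -- `A(t₁) c = 0`, contradiction with `det A(t₁) ≠ 0`
  refine hdet (Matrix.exists_mulVec_eq_zero_iff.1 ⟨c, hcne, ?_⟩)
  funext i
  have hcoef : g.val (maximalGeodesic g.leviCivita q uq t₁) u (f t₁ (some i)) = 0 := by
    rw [hu0, map_zero, zero_apply]
  simp only [hu, map_sum, map_smul, FunLike.coe_sum, FunLike.coe_smul, Finset.sum_apply,
    Pi.smul_apply, smul_eq_mul] at hcoef
  simp only [Matrix.mulVec, dotProduct, Matrix.of_apply, Pi.zero_apply]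
  refine (Finset.sum_congr rfl fun j _ ↦ ?_).trans hcoef
  rw [hJ j, mul_comm]

end Conjugate
section CongrHelpers

variable {E : Type*} [NormedAddCommGroup E] [NormedSpace ℝ E] {M : Type*} [TopologicalSpace M]
  [ChartedSpace E M]

/-- Transport of a frame vector along an equality of parameters (all tangent spaces are `E`).
[folklore] -/
theorem frame_congr_param {γ : ℝ → M} {ι : Type*} (f : Π t : ℝ, ι → TangentSpace 𝓘(ℝ, E) (γ t))
    {a b : ℝ} (h : a = b) (o : ι) : (show E from f a o) = (show E from f b o) := by
  subst h; rfl

variable [IsManifold 𝓘(ℝ, E) ∞ M]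
  (g : PseudoRiemannianMetric 𝓘(ℝ, E) ∞ E (TangentSpace 𝓘(ℝ, E) : M → Type _))

/-- Transport of `g(R(·,·)·, ·)` along an equality of base points. [folklore] -/
theorem val_curvature_congr_basePoint [g.HasLeviCivita] {x y : M} (h : x = y) (a b c d : E) :
    g.val x (g.leviCivita.curvature x a b c) d = g.val y (g.leviCivita.curvature y a b c) d := by
  subst h; rfl

end CongrHelpers

section ConjugateMain

variable {E : Type*} [NormedAddCommGroup E] [NormedSpace ℝ E] [FiniteDimensional ℝ E]
  [CompleteSpace E] {M : Type*} [TopologicalSpace M] [ChartedSpace E M] [IsManifold 𝓘(ℝ, E) ∞ M]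
  [T2Space M]
  (g : PseudoRiemannianMetric 𝓘(ℝ, E) ∞ E (TangentSpace 𝓘(ℝ, E) : M → Type _)) [g.HasLeviCivita]
  [CovariantDerivative.ContMDiffCovariantDerivative g.leviCivita 1]
  [CovariantDerivative.ContMDiffCovariantDerivative g.leviCivita ∞]

set_option synthInstance.maxHeartbeats 400000 in
set_option maxHeartbeats 1600000 in
/-- **No conjugacy from an interior point to the far end of a minimal segment.** For
`γ(t) = exp_p(tu)`, `|u| = 1`, minimizing on `[0, T]`, `0 < ε < T`, `q = γ(ε)`: the differential
`d(exp_q)` at `(T - ε) γ̇(ε)` is injective, i.e. `x = γ(T)` is not conjugate to `q` along `γ`.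
Proof: a kernel vector makes the normal Jacobi tensor `A` from `q` singular at `t₁ = T - ε`
(`det_jacobi_eq_zero_of_mfderiv_expMap_eq_zero`); the normal Jacobi tensor `Ā` from `x` along the
reversed geodesic, in the reversed frame, solves the reversed system, so `det Ā(t₁) = 0`
(`Matrix.det_eq_zero_of_reversed_jacobi`); but the reversed segment extends minimally beyond `q`
(to `p`), so `t₁ ū ∈ ID(x)` and `d(exp_x)_{t₁ū}` is injective (Lee Thm. 10.26,
`mfderiv_riemannianExpMap_injective_of_mem_injectivityDomain`), `det Ā(t₁) ≠ 0`.
[cite: LeeRiemannianManifolds2018, Thm. 10.26] -/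
theorem injective_mfderiv_expMap_far_end [ConnectedSpace M] (hg : g.IsRiemannian)
    (hc : IsGeodesicallyComplete g.leviCivita) (p : M) (u : TangentSpace 𝓘(ℝ, E) p)
    (hu : g.val p u u = 1) {T : ℝ} (hmin : IsMinimizingUpTo g hg p u T) {ε : ℝ} (hε : 0 < ε)
    (hεT : ε < T) :
    Injective (mfderiv 𝓘(ℝ, E) 𝓘(ℝ, E)
      (fun w : E ↦ expMap g.leviCivita (expMap g.leviCivita p (ε • u))
        (show TangentSpace 𝓘(ℝ, E) (expMap g.leviCivita p (ε • u)) from w))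
      ((T - ε) • (show E from velocity 𝓘(ℝ, E) (fun t ↦ expMap g.leviCivita p (t • u)) ε))) := by
  classical
  haveI : Fact ((1 : ℕ∞ω) ≤ (∞ : ℕ∞ω)) := ⟨by exact_mod_cast le_top⟩
  have hLC := PseudoRiemannianMetric.isLeviCivita_leviCivita_holds (g := g)
  have h2le : (2 : ℕ∞ω) ≤ (∞ : ℕ∞ω) := WithTop.coe_le_coe.2 le_top
  have hreg1 : g.leviCivita.IsLocallyContMDiff 1 := hLC.isLocallyContMDiff_one h2le
  have hT : 0 < T := hε.trans hεT
  -- notation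
  set γ : ℝ → M := fun t ↦ expMap g.leviCivita p (t • u) with hγ_def
  set q : M := expMap g.leviCivita p (ε • u) with hq_def
  set uq : TangentSpace 𝓘(ℝ, E) q := velocity 𝓘(ℝ, E) γ ε with huq_def
  set t₁ : ℝ := T - ε with ht₁_def
  have ht₁ : 0 < t₁ := by rw [ht₁_def]; linarith
  have huq1 : g.val q uq uq = 1 := by
    have h := val_velocity_expMap_smul g hc p u ε
    rw [hu] at h
    exact h
  -- the geodesic from `q`: `γ_q(σ) = γ(ε + σ)`
  have hγq : ∀ σ : ℝ, maximalGeodesic g.leviCivita q uq σ = γ (σ + ε) := fun σ ↦ by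
    rw [maximalGeodesic_velocity_eq g hc p u ε σ, add_comm]
  have hvelq : ∀ r : ℝ, (show E from velocity 𝓘(ℝ, E) (maximalGeodesic g.leviCivita q uq) r) =
      (show E from velocity 𝓘(ℝ, E) γ (r + ε)) := fun r ↦ by
    rw [velocity_congr_of_forall (γ := fun σ : ℝ ↦ γ (σ + ε))
      (γ' := maximalGeodesic g.leviCivita q uq) hγq r, velocity_translate γ ε r]
  by_contra hinj
  -- a nonzero kernel vector
  obtain ⟨k, hk, hk0⟩ : ∃ k : E, mfderiv 𝓘(ℝ, E) 𝓘(ℝ, E)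
      (fun w : E ↦ expMap g.leviCivita q (show TangentSpace 𝓘(ℝ, E) q from w))
      (t₁ • (show E from uq)) k = 0 ∧ k ≠ 0 := by
    rw [injective_iff_map_eq_zero] at hinj
    simp only [not_forall, exists_prop] at hinj
    obtain ⟨k, hk, hk0⟩ := hinj
    exact ⟨k, hk, hk0⟩
  -- the interval `(t₁ - L₀, L₀)`, symmetric under `s ↦ t₁ - s`
  set L₀ : ℝ := T + 1 with hL₀
  have h0 : (0 : ℝ) ∈ Ioo (t₁ - L₀) L₀ := ⟨by rw [ht₁_def, hL₀]; linarith, by rw [hL₀]; linarith⟩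
  have ht₁I : t₁ ∈ Ioo (t₁ - L₀) L₀ := ⟨by rw [hL₀]; linarith, by rw [ht₁_def, hL₀]; linarith⟩
  have hrefl : ∀ {s : ℝ}, s ∈ Ioo (t₁ - L₀) L₀ → t₁ - s ∈ Ioo (t₁ - L₀) L₀ := fun hs ↦
    ⟨by linarith [hs.2], by linarith [hs.1]⟩
  -- (1) the frame and the Jacobi tensor from `q`
  obtain ⟨k', f, hfnone, hfpar, hon, hcard⟩ :=
    exists_fullFrame_along_maximalGeodesic g hg hc q uq huq1 h0
  obtain ⟨hA, hA₁, -, -, hA0, hA₁0, -, hnormal⟩ :=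
    normalJacobiTensor_frame_explicit g hreg1 h2le hc q uq h0 f hfnone hfpar hon hcard
  have hdetq := det_jacobi_eq_zero_of_mfderiv_expMap_eq_zero g hc q uq f hfnone hon hcard h0
    (fun j ↦ (show E from f 0 (some j))) (fun j ↦ rfl) ht₁I ht₁.ne' (fun j ↦ hnormal j t₁) hk0 hk
  -- (2) the reversed geodesic from `x = γ(T)` and the reversed frame
  set x : M := expMap g.leviCivita p (T • u) with hx_def
  obtain ⟨ū, hū1, hpath, hvel, hminx⟩ := exists_reversed_unit g hg hc p u hu hT hmin
  have hpt : ∀ s : ℝ, maximalGeodesic g.leviCivita x ū s = maximalGeodesic g.leviCivita q uq (t₁ - s) :=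
    fun s ↦ by
    rw [hpath s, hγq (t₁ - s)]
    show γ (T - s) = γ (t₁ - s + ε)
    rw [ht₁_def]; congr 1; ring
  have hvelx : ∀ s : ℝ, (show E from velocity 𝓘(ℝ, E) (maximalGeodesic g.leviCivita x ū) s) =
      -(show E from velocity 𝓘(ℝ, E) (maximalGeodesic g.leviCivita q uq) (t₁ - s)) := by
    intro s
    have e1 : (show E from velocity 𝓘(ℝ, E) (maximalGeodesic g.leviCivita x ū) s) =
        (-1 : ℝ) • (show E from velocity 𝓘(ℝ, E) γ (T - s)) := hvel s
    have e2 : (-1 : ℝ) • (show E from velocity 𝓘(ℝ, E) γ (T - s)) =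
        (-1 : ℝ) • (show E from velocity 𝓘(ℝ, E) γ (t₁ - s + ε)) :=
      congrArg (fun z : E ↦ (-1 : ℝ) • z) (velocity_congr_point (I := 𝓘(ℝ, E)) (γ := γ)
        (show T - s = t₁ - s + ε by rw [ht₁_def]; ring))
    have e3 : (-1 : ℝ) • (show E from velocity 𝓘(ℝ, E) γ (t₁ - s + ε)) =
        (-1 : ℝ) • (show E from velocity 𝓘(ℝ, E) (maximalGeodesic g.leviCivita q uq) (t₁ - s)) :=
      congrArg (fun z : E ↦ (-1 : ℝ) • z) (hvelq (t₁ - s)).symm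
    exact (e1.trans (e2.trans e3)).trans (neg_one_smul ℝ _)
  set fb : Π s : ℝ, Option (Fin k') → TangentSpace 𝓘(ℝ, E) (maximalGeodesic g.leviCivita x ū s) :=
    fun s o ↦ o.elim (velocity 𝓘(ℝ, E) (maximalGeodesic g.leviCivita x ū) s)
      (fun i ↦ f (t₁ - s) (some i)) with hfb
  have hfbnone : ∀ s, fb s none = velocity 𝓘(ℝ, E) (maximalGeodesic g.leviCivita x ū) s :=
    fun s ↦ rfl
  -- parallelism of the reversed normal frame
  have hcurve : (fun s : ℝ ↦ maximalGeodesic g.leviCivita q uq ((-1) * s + t₁)) =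
      maximalGeodesic g.leviCivita x ū := by
    funext s
    rw [hpt s]
    congr 1; ring
  have hfbpar : ∀ i, IsParallelAlongOn g.leviCivita (maximalGeodesic g.leviCivita x ū)
      (fun s ↦ fb s (some i)) (Ioo (t₁ - L₀) L₀) := by
    intro i
    have h1 := (hfpar i).comp_affine (-1) t₁
    have h2 := isParallelAlongOn_congr_curve g hcurve h1
    have hW : (fun s : ℝ ↦ (show TangentSpace 𝓘(ℝ, E) (maximalGeodesic g.leviCivita x ū s) from
        (show E from f ((-1) * s + t₁) (some i)))) = fun s ↦ fb s (some i) :=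
      funext fun s ↦ frame_congr_param f (show (-1) * s + t₁ = t₁ - s by ring) (some i)
    rw [hW] at h2
    refine h2.mono ?_
    intro s hs
    show (-1) * s + t₁ ∈ Ioo (t₁ - L₀) L₀
    exact ⟨by linarith [hs.2], by linarith [hs.1]⟩
  -- the reversed velocity, read in `T_{γ_q(t₁ - s)}M`
  have hvelx' : ∀ s : ℝ, @Eq (TangentSpace 𝓘(ℝ, E) (maximalGeodesic g.leviCivita q uq (t₁ - s)))
      (velocity 𝓘(ℝ, E) (maximalGeodesic g.leviCivita x ū) s)
      (-(velocity 𝓘(ℝ, E) (maximalGeodesic g.leviCivita q uq) (t₁ - s))) :=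
    fun s ↦ hvelx s
  -- orthonormality of the reversed frame
  have hfbon : ∀ s ∈ Ioo (t₁ - L₀) L₀, ∀ o o', g.val (maximalGeodesic g.leviCivita x ū s)
      (fb s o) (fb s o') = if o = o' then 1 else 0 := by
    intro s hs o o'
    have hr := hrefl hs
    have hon' := hon (t₁ - s) hr
    rcases o with _ | i <;> rcases o' with _ | j
    · show g.val (maximalGeodesic g.leviCivita x ū s)
        (velocity 𝓘(ℝ, E) (maximalGeodesic g.leviCivita x ū) s)
        (velocity 𝓘(ℝ, E) (maximalGeodesic g.leviCivita x ū) s) = _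
      rw [QuotientMetric.val_eq_of_eq g (hpt s) _ _, hvelx' s]
      simp only [map_neg, neg_apply, neg_neg]
      rw [← hfnone (t₁ - s)]
      exact hon' none none
    · show g.val (maximalGeodesic g.leviCivita x ū s)
        (velocity 𝓘(ℝ, E) (maximalGeodesic g.leviCivita x ū) s) (f (t₁ - s) (some j)) = _
      rw [QuotientMetric.val_eq_of_eq g (hpt s) _ _, hvelx' s]
      simp only [map_neg, neg_apply]
      rw [← hfnone (t₁ - s)]
      have h := hon' none (some j)
      simp only [reduceCtorEq, if_false] at h ⊢
      rw [neg_eq_zero]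
      exact h
    · show g.val (maximalGeodesic g.leviCivita x ū s) (f (t₁ - s) (some i))
        (velocity 𝓘(ℝ, E) (maximalGeodesic g.leviCivita x ū) s) = _
      rw [QuotientMetric.val_eq_of_eq g (hpt s) _ _, hvelx' s]
      simp only [map_neg]
      rw [← hfnone (t₁ - s)]
      have h := hon' (some i) none
      simp only [reduceCtorEq, if_false] at h ⊢
      rw [neg_eq_zero]
      exact h
    · show g.val (maximalGeodesic g.leviCivita x ū s) (f (t₁ - s) (some i)) (f (t₁ - s) (some j)) = _
      rw [QuotientMetric.val_eq_of_eq g (hpt s) _ _]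
      have h := hon' (some i) (some j)
      simp only [Option.some.injEq] at h ⊢
      exact h
  -- (3) the Jacobi tensor from `x` in the reversed frame
  obtain ⟨hB, hB₁, hSsymm, -, hB0, -, hdetx, -⟩ :=
    normalJacobiTensor_frame_explicit g hreg1 h2le hc x ū h0 fb hfbnone hfbpar hfbon hcard
  -- `t₁ ū ∈ ID(x)` (the reversed segment minimises up to `T > t₁`), so `det Ā(t₁) ≠ 0`
  have hID : t₁ • ū ∈ injectivityDomain g hg x := by
    refine ⟨T / t₁, (one_lt_div ht₁).2 (by rw [ht₁_def]; linarith), ?_⟩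
    rw [isMinimizingUpTo_smul_iff hg hc x ū ht₁, mul_div_cancel₀ T ht₁.ne']
    exact hminx
  have hinjx := mfderiv_riemannianExpMap_injective_of_mem_injectivityDomain g le_rfl hg hc x hID
  have hdetx' := hdetx t₁ ht₁I ht₁.ne' hinjx
  -- (4) the reversed system has `S(s) = R(t₁ - s)`
  refine hdetx' (Matrix.det_eq_zero_of_reversed_jacobi (t₁ := t₁) h0.1 ht₁I.2 ht₁.le hA hA₁ hA0 hA₁0
    hB hB₁ hB0 hSsymm ?_ hdetq)
  intro s hs hs'
  ext i j
  simp only [Matrix.of_apply]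
  show g.val (maximalGeodesic g.leviCivita x ū s) (g.leviCivita.curvature
      (maximalGeodesic g.leviCivita x ū s) (f (t₁ - s) (some j))
      (velocity 𝓘(ℝ, E) (maximalGeodesic g.leviCivita x ū) s)
      (velocity 𝓘(ℝ, E) (maximalGeodesic g.leviCivita x ū) s)) (f (t₁ - s) (some i)) = _
  rw [val_curvature_congr_basePoint g (hpt s), hvelx' s]
  simp only [map_neg, neg_apply, neg_neg]

end ConjugateMain
/-! ### §4 Calabi's lemma and the smooth upper barriers -/

section Assembly

variable {E : Type*} [NormedAddCommGroup E] [NormedSpace ℝ E] [FiniteDimensional ℝ E]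
  [CompleteSpace E] {M : Type*} [TopologicalSpace M] [ChartedSpace E M] [IsManifold 𝓘(ℝ, E) ∞ M]
  [T2Space M]
  (g : PseudoRiemannianMetric 𝓘(ℝ, E) ∞ E (TangentSpace 𝓘(ℝ, E) : M → Type _)) [g.HasLeviCivita]
  [CovariantDerivative.ContMDiffCovariantDerivative g.leviCivita 1]
  [CovariantDerivative.ContMDiffCovariantDerivative g.leviCivita ∞]

set_option maxHeartbeats 800000 in
/-- **Calabi's lemma: the far endpoint of a minimal geodesic is not a cut point of its interior
points.** For `γ(t) = exp_p(tu)`, `|u| = 1`, minimizing on `[0, T]`, and `0 < ε < T`, the vector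
`(T - ε) γ̇(ε)` lies in the injectivity domain `ID(γ(ε))`: the geodesic from `q = γ(ε)` through
`x = γ(T)` minimizes a little beyond `x` (Petersen 2016, proof of Lemma 7.1.9; Calabi 1958).
Proof: otherwise `(T - ε)γ̇(ε) ∈ TCL(q)`, so by Klingenberg's dichotomy
(`isConjugateVector_or_exists_ne_of_mem_tangentCutLocus`) either it is a conjugate vector —
excluded by `injective_mfderiv_expMap_far_end` — or there is a second minimizer from `q` to `x`,
whose reversal together with the reversed segment from `x` (which extends minimally to `p`)
contradicts `false_of_two_minimizers`. [cite: Petersen2016, Lemma 7.1.9 (proof)] [cite: Calabi1958] -/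
theorem smul_velocity_mem_injectivityDomain [ConnectedSpace M] (hg : g.IsRiemannian)
    (hc : IsGeodesicallyComplete g.leviCivita) (p : M) (u : TangentSpace 𝓘(ℝ, E) p)
    (hu : g.val p u u = 1) {T : ℝ} (hmin : IsMinimizingUpTo g hg p u T) {ε : ℝ} (hε : 0 < ε)
    (hεT : ε < T) :
    ((T - ε) • velocity 𝓘(ℝ, E) (fun t ↦ expMap g.leviCivita p (t • u)) ε) ∈
      injectivityDomain g hg (expMap g.leviCivita p (ε • u)) := by
  haveI : Fact ((1 : ℕ∞ω) ≤ (∞ : ℕ∞ω)) := ⟨by exact_mod_cast le_top⟩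
  have hT : 0 < T := hε.trans hεT
  set γ : ℝ → M := fun t ↦ expMap g.leviCivita p (t • u) with hγ_def
  set q : M := expMap g.leviCivita p (ε • u) with hq_def
  set uq : TangentSpace 𝓘(ℝ, E) q := velocity 𝓘(ℝ, E) γ ε with huq_def
  set t₁ : ℝ := T - ε with ht₁_def
  have ht₁ : 0 < t₁ := by rw [ht₁_def]; linarith
  have huq1 : g.val q uq uq = 1 := by
    have h := val_velocity_expMap_smul g hc p u ε
    rw [hu] at h
    exact h
  have hγq : ∀ σ : ℝ, maximalGeodesic g.leviCivita q uq σ = γ (σ + ε) := fun σ ↦ by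
    rw [maximalGeodesic_velocity_eq g hc p u ε σ, add_comm]
  obtain ⟨hdomq, -, -, -⟩ := maximalGeodesic_of_isGeodesicallyComplete hc q uq
  -- `x = γ(T) = exp_q(t₁ u_q)` and `d(q, x) = t₁`
  set x : M := expMap g.leviCivita p (T • u) with hx_def
  have hqx : expMap g.leviCivita q (t₁ • uq) = x := by
    rw [expMap_smul hc q uq t₁, hγq t₁]
    show γ (T - ε + ε) = γ T
    rw [sub_add_cancel]
  have hdqx : g.edist hg q x = ENNReal.ofReal t₁ :=
    edist_expMap_smul_expMap_smul g hg hc p u hu hmin hε.le hεT.le le_rfl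
  -- `t₁ u_q` is minimizing up to `1`
  have hmin1 : IsMinimizingUpTo g hg q (t₁ • uq) 1 := by
    rw [isMinimizingUpTo_smul_iff hg hc q uq ht₁, mul_one]
    refine ⟨by rw [hdomq]; exact subset_univ _, ?_⟩
    rw [length_maximalGeodesic hg hc q uq 0 t₁, huq1, Real.sqrt_one, mul_one, sub_zero, hγq t₁]
    show ENNReal.ofReal t₁ = g.edist hg q (γ (T - ε + ε))
    rw [sub_add_cancel]
    exact hdqx.symm
  by_contra hnot
  -- then `t₁ u_q ∈ TCL(q)`
  have huq0 : uq ≠ 0 := fun h ↦ by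
    rw [h, map_zero] at huq1
    exact zero_ne_one huq1
  have hTCL : t₁ • uq ∈ tangentCutLocus g hg q :=
    ⟨smul_ne_zero ht₁.ne' huq0, hmin1, fun s hs h ↦ hnot ⟨s, hs, h⟩⟩
  rcases isConjugateVector_or_exists_ne_of_mem_tangentCutLocus le_rfl hg hc hTCL with
    hconj | ⟨w', hw'ne, hw'min, hw'x⟩
  · -- the conjugate case
    exact hconj.2 (injective_mfderiv_expMap_far_end g hg hc p u hu hmin hε hεT)
  · -- a second minimizer from `q` to `x`: reverse it and the segment
    have hw'x' : expMap g.leviCivita q w' = x := by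
      have h : riemannianExpMap g q w' = riemannianExpMap g q (t₁ • uq) := hw'x
      simp only [riemannianExpMap] at h
      rw [h, hqx]
    obtain ⟨v', hv'min, hv'q, -, hv'path⟩ := exists_reverse_minimizing hg hc hw'min hw'x'
    obtain ⟨ū, hū1, hpath, -, hminx⟩ := exists_reversed_unit g hg hc p u hu hT hmin
    -- `t₁ ū` minimizes up to `T / t₁ > 1` and reaches `q`
    have hs : 1 < T / t₁ := (one_lt_div ht₁).2 (by rw [ht₁_def]; linarith)
    have hmins : IsMinimizingUpTo g hg x (t₁ • ū) (T / t₁) := by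
      rw [isMinimizingUpTo_smul_iff hg hc x ū ht₁, mul_div_cancel₀ T ht₁.ne']
      exact hminx
    have hxq : expMap g.leviCivita x (t₁ • ū) = q := by
      rw [expMap_smul hc x ū t₁, hpath t₁]
      show γ (T - (T - ε)) = γ ε
      rw [sub_sub_cancel]
    -- the two minimizers from `x` to `q` differ
    have hne : t₁ • ū ≠ v' := by
      intro heq
      apply hw'ne
      -- both radial geodesics from `q` coincide: `exp_q(r w') = exp_q(r t₁ u_q)` for all `r`
      have hpaths : ∀ r : ℝ, expMap g.leviCivita q (r • w') = expMap g.leviCivita q (r • (t₁ • uq)) := by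
        intro r
        have h1 := hv'path (1 - r)
        rw [sub_sub_cancel, ← heq, smul_smul, expMap_smul hc x ū ((1 - r) * t₁), hpath] at h1
        rw [← h1, smul_smul, expMap_smul hc q uq (r * t₁), hγq]
        show γ (T - (1 - r) * t₁) = γ (r * t₁ + ε)
        rw [ht₁_def]; exact congrArg γ (by ring)
      have h := velocity_congr_of_forall (I := 𝓘(ℝ, E)) (γ := fun r : ℝ ↦ expMap g.leviCivita q (r • (t₁ • uq)))
        (γ' := fun r : ℝ ↦ expMap g.leviCivita q (r • w')) hpaths 0
      rw [velocity_expMap_smul_zero, velocity_expMap_smul_zero] at h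
      exact h
    exact false_of_two_minimizers g le_rfl hg hc x hne (hxq.trans hv'q.symm) hv'min hs hmins

end Assembly
section Barrier

variable {E : Type*} [NormedAddCommGroup E] [NormedSpace ℝ E] [FiniteDimensional ℝ E]
  [CompleteSpace E] {M : Type*} [TopologicalSpace M] [ChartedSpace E M] [IsManifold 𝓘(ℝ, E) ∞ M]
  [T2Space M]
  (g : PseudoRiemannianMetric 𝓘(ℝ, E) ∞ E (TangentSpace 𝓘(ℝ, E) : M → Type _)) [g.HasLeviCivita]
  [CovariantDerivative.ContMDiffCovariantDerivative g.leviCivita 1]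
  [CovariantDerivative.ContMDiffCovariantDerivative g.leviCivita ∞]

/-- **Calabi's smooth upper barriers for the distance function** (Calabi 1958; Petersen 2016,
proof of Lemma 7.1.9; Cheeger–Colding 1996, §1): on a connected Riemannian `m`-manifold with
complete Levi-Civita connection and `Ric ≥ -(m-1) g`, let `x ≠ p`, `T = d(p, x)` and
`0 < ε < T`. Then there is a point `q` (namely `γ(ε)` on a minimal geodesic `γ` from `p` to `x`)
with `d(p, q) = ε`, `d(q, x) = T - ε`, such that `d(q, ·)` is `C^∞` at `x` and
`Δ d(q, ·)(x) ≤ (m - 1) coth(T - ε)`; by the triangle inequality `ε + d(q, ·) ≥ d(p, ·)`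
everywhere, with equality at `x` — so `ε + d(q, ·)` is a smooth upper support function of
`d(p, ·)` at `x` with Laplacian `≤ (m-1) coth(d(p, x) - ε)`.
[cite: Calabi1958] [cite: Petersen2016, Lemma 7.1.9 (proof)] [cite: CheegerColding1996, §1] -/
theorem exists_smooth_upper_barrier_edist [ConnectedSpace M] (hg : g.IsRiemannian)
    (hc : IsGeodesicallyComplete g.leviCivita)
    (hRic : ∀ (x : M) (w : TangentSpace 𝓘(ℝ, E) x),
      -((Module.finrank ℝ E : ℝ) - 1) * g.val x w w ≤ g.leviCivita.ricci x w w)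
    {p x : M} (hxp : x ≠ p) {ε : ℝ} (hε : 0 < ε) (hεT : ε < (g.edist hg p x).toReal) :
    ∃ q : M, g.edist hg p q = ENNReal.ofReal ε ∧
      g.edist hg q x = ENNReal.ofReal ((g.edist hg p x).toReal - ε) ∧
      (∀ z : M, g.edist hg p z ≤ ENNReal.ofReal ε + g.edist hg q z) ∧
      ContMDiffAt 𝓘(ℝ, E) 𝓘(ℝ, ℝ) ∞ (fun z ↦ (g.edist hg q z).toReal) x ∧
      g.laplaceBeltrami (fun z ↦ (g.edist hg q z).toReal) x ≤
        ((Module.finrank ℝ E : ℝ) - 1) *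
          (Real.cosh ((g.edist hg p x).toReal - ε) / Real.sinh ((g.edist hg p x).toReal - ε)) := by
  haveI : Fact ((1 : ℕ∞ω) ≤ (∞ : ℕ∞ω)) := ⟨by exact_mod_cast le_top⟩
  obtain ⟨u, T, hu, hT, hTx, hx⟩ := exists_unit_speed_expMap_eq_of_ne g hg hc hxp
  subst hx
  rw [← hTx] at hεT ⊢
  -- `γ_u|[0, T]` is minimizing
  obtain ⟨hdom, -, -, -⟩ := maximalGeodesic_of_isGeodesicallyComplete hc p u
  have hdT : g.edist hg p (expMap g.leviCivita p (T • u)) = ENNReal.ofReal T :=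
    calc g.edist hg p (expMap g.leviCivita p (T • u))
        = ENNReal.ofReal ((g.edist hg p (expMap g.leviCivita p (T • u))).toReal) :=
          (ENNReal.ofReal_toReal (edist_ne_top hg _ _)).symm
      _ = ENNReal.ofReal T := by rw [← hTx]
  have hmin : IsMinimizingUpTo g hg p u T := by
    refine ⟨by rw [hdom]; exact subset_univ _, ?_⟩
    rw [length_maximalGeodesic hg hc p u 0 T, hu, Real.sqrt_one, mul_one, sub_zero,
      ← expMap_smul hc p u T, hdT]
  -- the point `q = γ(ε)` and Calabi's lemma
  set q : M := expMap g.leviCivita p (ε • u) with hq_def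
  set uq : TangentSpace 𝓘(ℝ, E) q := velocity 𝓘(ℝ, E) (fun t ↦ expMap g.leviCivita p (t • u)) ε
    with huq_def
  have hID := smul_velocity_mem_injectivityDomain g hg hc p u hu hmin hε hεT
  have hqx : expMap g.leviCivita q ((T - ε) • uq) = expMap g.leviCivita p (T • u) := by
    rw [expMap_smul hc q uq (T - ε), maximalGeodesic_velocity_eq g hc p u ε (T - ε)]
    congr 2; ring
  have huq1 : g.val q uq uq = 1 := by
    have h := val_velocity_expMap_smul g hc p u ε
    rw [hu] at h
    exact h
  have hw0 : (T - ε) • uq ≠ 0 := by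
    refine smul_ne_zero (by linarith) fun h ↦ ?_
    rw [h, map_zero] at huq1
    exact zero_ne_one huq1
  refine ⟨q, ?_, ?_, ?_, ?_, ?_⟩
  · have h := edist_expMap_smul_expMap_smul g hg hc p u hu hmin (s := 0) (t := ε) le_rfl hε.le hεT.le
    rwa [zero_smul, expMap_zero (cov := g.leviCivita), sub_zero] at h
  · exact edist_expMap_smul_expMap_smul g hg hc p u hu hmin hε.le hεT.le le_rfl
  · intro z
    have h1 : g.edist hg p q = ENNReal.ofReal ε := by
      have h := edist_expMap_smul_expMap_smul g hg hc p u hu hmin (s := 0) (t := ε) le_rfl hε.le hεT.le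
      rwa [zero_smul, expMap_zero (cov := g.leviCivita), sub_zero] at h
    rw [← h1]
    exact g.edist_triangle hg p q z
  · have h := contMDiffAt_edist_toReal_of_mem_injectivityDomain g hg hc q hID hw0
    rwa [hqx] at h
  · have h := laplaceBeltrami_edist_le_coth_of_mem_injectivityDomain g hg hc hRic q hID hw0
    rw [hqx] at h
    refine h.trans (le_of_eq ?_)
    rw [edist_expMap_smul_expMap_smul g hg hc p u hu hmin hε.le hεT.le le_rfl,
      ENNReal.toReal_ofReal (by linarith)]

end Barrier
end Literature.Geometry.Riemannian
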